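import Summits.FinalStateConjecture.FinalStateConjecture.Theorems.EIHFluxBalanceInertialRecessionStubEndgameOracleBandsPrep

/-!
# Route EIHFluxBalance — crux `InertialRecession`, line `sublinear-is-free-clean-window-charges`:
# the increment oracle for a SLOW SYSTEM WITHOUT OUTSIDERS (every `N`): the band iteration

Helper file for the crux `stmt-FinalStateConjecture-10166`
(`Summit.FinalStateConjecture.FinalStateConjecture.Theses.EIHFluxBalance.InertialRecession`), registered stub `stub_incrementOracle`
(lead reshape r9/r10) of `Cruxes/InertialRecession/Lines/sublinear_is_free_clean_window_charges.lean`; continues `…OracleBandsPrep`.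

`univ_slow_segment` / `univ_slow_increment`: the member set `S = univ` case of the increment ORACLE, for every `N`. The system is
internally slow (`|‖ξₖ − ξₗ‖(s₁) − ‖ξₖ − ξₗ‖(s₀)| ≤ σ(s₁ − s₀)`, `σ ≤ c₀λ_min`); at the current time `u` an EMPTY BAND `[λ, 16λ)` of the
scale-`t` ratios (`λ ≥ λ_min = 2⁻¹16^{-(N²+1)}`) defines classes (ratio `< λ`, transitive) which stay classes as long as all cross
ratios stay `≥ 4λ` (in-class ratios never cross `λ` upwards): on that segment every class is a TIGHT PIECE whose non-members are far
(`≥ 4λc₀s`), so `tight_increment_mixed` / `univ_increment` bound its increment by `X`, and the total by `N·X`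
(`abs_sub_sum_classes_le`). The segment ends when a cross ratio reaches `4λ` — then the FUEL `#{(pair, b) : ratio ≥ 2⁻¹16^{-b}}`
has dropped (that ratio was `≥ 16λ` at `u`, and no ratio crosses a grid level upwards), so at most `N²(N²+2) + 1` segments are needed:
`|ΔE|, |ΔΠ^k| ≤ (N²(N²+2) + 1)·N·X` on `[t₁,t₂]`, `X = C(2c₀^{-3/2} + 4N(4λ_min c₀)^{-3/2})t₁^{-1/2} + 2ζ⋆`.
-/

noncomputable section

set_option linter.dupNamespace false

open Filter Topology Set MeasureTheory intervalIntegral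
open scoped Topology BigOperators InnerProductSpace RealInnerProductSpace

namespace Summit.FinalStateConjecture.FinalStateConjecture.Theorems.SublinearIsFree.Oracle

open Literature.Geometry.Lorentzian
open Summit.FinalStateConjecture.FinalStateConjecture.Theorems.SublinearIsFree.Endgame

set_option maxHeartbeats 1600000 in
/-- **ONE SEGMENT OF THE BAND ITERATION** (see the module docstring): from any `u ∈ [t₁,t₂]` there is `τ ∈ [u,t₂]` with the class-wise
increment bound `N·X` on `[u,τ]` and either `τ = t₂` or a strictly smaller fuel at `τ`. [folklore] -/
theorem univ_slow_segment {N : ℕ} (M : Fin N → ℝ) (ξ v : Fin N → ℝ → E3) (κ : ℝ) (P : ℝ → E3 → ℝ → Fin 4 → ℝ)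
    (ρ : ℝ → ℝ) (C T T' T₀ : ℝ) (ζ : ℝ → ℝ)
    (hWL : ∀ (t₁ t₂ : ℝ) (c : ℝ → E3) (R : ℝ → ℝ), T ≤ t₁ → t₁ ≤ t₂ →
      (∀ s ∈ Set.Icc t₁ t₂, ∀ s' ∈ Set.Icc t₁ t₂, ‖c s - c s'‖ ≤ 2 * |s - s'| ∧ |R s - R s'| ≤ 2 * |s - s'|) →
      (∀ s ∈ Set.Icc t₁ t₂, ρ s ≤ (1 / 2) * R s ∧ ‖c s‖ + R s ≤ (κ + κ ^ 2) / 2 * s ∧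
        ∀ j, ‖ξ j s - c s‖ ≤ (1 - 1 / 2) * R s ∨ (1 + 1 / 2) * R s ≤ ‖ξ j s - c s‖) →
      ∀ μ : Fin 4, |P t₂ (c t₂) (R t₂) μ - P t₁ (c t₁) (R t₁) μ| ≤ C * ∫ s in t₁..t₂, (R s ^ (3 / 2 : ℝ))⁻¹)
    (hID : ∀ (t : ℝ) (c : E3) (R : ℝ) (A : Finset (Fin N)), T' ≤ t → ρ t ≤ (1 / 2) * R →
      ‖c‖ + R ≤ (κ + κ ^ 2) / 2 * t →
      (∀ j, ‖ξ j t - c‖ ≤ (1 - 1 / 2) * R ∨ (1 + 1 / 2) * R ≤ ‖ξ j t - c‖) →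
      (∀ j, j ∈ A ↔ ‖ξ j t - c‖ ≤ (1 - 1 / 2) * R) →
      |P t c R 0 - ∑ j ∈ A, M j * (√(1 - ‖v j t‖ ^ 2))⁻¹| ≤ ζ t ∧
      ∀ k : Fin 3, |P t c R k.succ - ∑ j ∈ A, M j * (√(1 - ‖v j t‖ ^ 2))⁻¹ * v j t k| ≤ ζ t)
    (hC : 0 ≤ C) (hκ0 : 0 < κ) (hκ1 : κ < 1)
    (hξ : ∀ i, ContDiff ℝ 1 (ξ i)) (hspeed1 : ∀ i s, T₀ ≤ s → ‖deriv (ξ i) s‖ ≤ 1)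
    {t₁ t₂ σ ζstar : ℝ} (hT : T ≤ t₁) (hT' : T' ≤ t₁) (hT₀ : T₀ ≤ t₁) (ht₁ : 0 < t₁)
    (hcone : ∀ i, ∀ s ∈ Set.Icc t₁ t₂, ‖ξ i s‖ ≤ κ ^ 2 * s)
    (hslow : ∀ k l, ∀ s₀ ∈ Set.Icc t₁ t₂, ∀ s₁ ∈ Set.Icc t₁ t₂, s₀ ≤ s₁ →
      |‖ξ k s₁ - ξ l s₁‖ - ‖ξ k s₀ - ξ l s₀‖| ≤ σ * (s₁ - s₀))
    (hσ : σ ≤ (κ - κ ^ 2) / 2 * (2⁻¹ / 16 ^ (N * N + 1)))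
    (hρ : ∀ s ∈ Set.Icc t₁ t₂, ρ s ≤ 4 / 3 * (2⁻¹ / 16 ^ (N * N + 1)) * ((κ - κ ^ 2) / 2) * s)
    (hζ : ∀ s ∈ Set.Icc t₁ t₂, ζ s ≤ ζstar)
    {u : ℝ} (hu : u ∈ Set.Icc t₁ t₂) :
    ∃ τ ∈ Set.Icc u t₂,
      (|∑ j, M j * (√(1 - ‖v j τ‖ ^ 2))⁻¹ - ∑ j, M j * (√(1 - ‖v j u‖ ^ 2))⁻¹| ≤
          N * (C * (2 * (((κ - κ ^ 2) / 2) ^ (3 / 2 : ℝ))⁻¹ * (t₁ ^ (1 / 2 : ℝ))⁻¹ +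
            N * (2 * (2 * ((4 * (2⁻¹ / 16 ^ (N * N + 1)) * ((κ - κ ^ 2) / 2)) ^ (3 / 2 : ℝ))⁻¹ * (t₁ ^ (1 / 2 : ℝ))⁻¹))) +
            2 * ζstar) ∧
        ∀ kk : Fin 3, |∑ j, M j * (√(1 - ‖v j τ‖ ^ 2))⁻¹ * v j τ kk - ∑ j, M j * (√(1 - ‖v j u‖ ^ 2))⁻¹ * v j u kk| ≤
          N * (C * (2 * (((κ - κ ^ 2) / 2) ^ (3 / 2 : ℝ))⁻¹ * (t₁ ^ (1 / 2 : ℝ))⁻¹ +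
            N * (2 * (2 * ((4 * (2⁻¹ / 16 ^ (N * N + 1)) * ((κ - κ ^ 2) / 2)) ^ (3 / 2 : ℝ))⁻¹ * (t₁ ^ (1 / 2 : ℝ))⁻¹))) +
            2 * ζstar)) ∧
      (τ = t₂ ∨
        ((((Finset.univ : Finset (Fin N × Fin N)) ×ˢ Finset.range (N * N + 2)).filter fun q ↦
            2⁻¹ / 16 ^ q.2 ≤ ‖ξ q.1.1 τ - ξ q.1.2 τ‖ / ((κ - κ ^ 2) / 2 * τ)).card + 1 ≤
         (((Finset.univ : Finset (Fin N × Fin N)) ×ˢ Finset.range (N * N + 2)).filter fun q ↦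
            2⁻¹ / 16 ^ q.2 ≤ ‖ξ q.1.1 u - ξ q.1.2 u‖ / ((κ - κ ^ 2) / 2 * u)).card)) := by
  classical
  -- constants
  set c₀ : ℝ := (κ - κ ^ 2) / 2 with hc₀def
  have hκκ : 0 < κ - κ ^ 2 := by nlinarith
  have hc₀ : 0 < c₀ := by positivity
  set lmin : ℝ := 2⁻¹ / 16 ^ (N * N + 1) with hlmin
  have hlmin_pos : 0 < lmin := by positivity
  set X : ℝ := C * (2 * (c₀ ^ (3 / 2 : ℝ))⁻¹ * (t₁ ^ (1 / 2 : ℝ))⁻¹ +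
      N * (2 * (2 * ((4 * lmin * c₀) ^ (3 / 2 : ℝ))⁻¹ * (t₁ ^ (1 / 2 : ℝ))⁻¹))) + 2 * ζstar with hX
  have hut : t₁ ≤ u := hu.1
  have hu0 : 0 < u := ht₁.trans_le hut
  -- ratios
  set r : Fin N → Fin N → ℝ → ℝ := fun k l s ↦ ‖ξ k s - ξ l s‖ / (c₀ * s) with hr
  have hcs : ∀ s, t₁ ≤ s → 0 < c₀ * s := fun s hs ↦ mul_pos hc₀ (ht₁.trans_le hs)
  have hr_lt_iff : ∀ k l s e, t₁ ≤ s → (r k l s < e ↔ ‖ξ k s - ξ l s‖ < e * (c₀ * s)) := fun k l s e hs ↦ by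
    simp only [hr]; rw [div_lt_iff₀ (hcs s hs)]
  have hr_le_iff : ∀ k l s e, t₁ ≤ s → (e ≤ r k l s ↔ e * (c₀ * s) ≤ ‖ξ k s - ξ l s‖) := fun k l s e hs ↦ by
    simp only [hr]; rw [le_div_iff₀ (hcs s hs)]
  -- NO UP-CROSSING of levels `e ≥ lmin`
  have noup : ∀ k l e, lmin ≤ e → ∀ s₀ ∈ Set.Icc t₁ t₂, ∀ s₁ ∈ Set.Icc t₁ t₂, s₀ ≤ s₁ → r k l s₀ < e → r k l s₁ < e := by
    intro k l e he s₀ hs₀ s₁ hs₁ h01 h0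
    rw [hr_lt_iff k l s₀ e hs₀.1] at h0
    rw [hr_lt_iff k l s₁ e hs₁.1]
    have hσe : σ ≤ c₀ * e := hσ.trans (by rw [hc₀def]; exact mul_le_mul_of_nonneg_left he (by positivity))
    exact dist_lt_level_of_lt (d := fun s ↦ ‖ξ k s - ξ l s‖) hσe (hslow k l s₀ hs₀ s₁ hs₁ h01) h01 h0
  -- the empty band at `u`
  set sfin : Finset ℝ := ((Finset.univ : Finset (Fin N)) ×ˢ (Finset.univ : Finset (Fin N))).image
    fun p ↦ r p.1 p.2 u with hsfin
  obtain ⟨j, hj, hfree⟩ := exists_emptyBand sfin (by norm_num : (0 : ℝ) < 2⁻¹) (by norm_num : (1 : ℝ) < 16)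
  have hjN : j ≤ N * N := by
    refine hj.trans ?_
    calc sfin.card ≤ ((Finset.univ : Finset (Fin N)) ×ˢ (Finset.univ : Finset (Fin N))).card := Finset.card_image_le
      _ = N * N := by simp
  set lam : ℝ := 2⁻¹ / 16 ^ (j + 1) with hlam
  have hlam_pos : 0 < lam := by positivity
  have h16lam : 16 * lam = 2⁻¹ / 16 ^ j := by
    rw [hlam, pow_succ]; field_simp
  have hlam_ge : lmin ≤ lam := by
    rw [hlmin, hlam]
    exact div_le_div_of_nonneg_left (by norm_num) (by positivity) (pow_le_pow_right₀ (by norm_num) (by omega))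
  have hlam_small : lam ≤ 1 / 32 := by
    rw [hlam]
    have : (16 : ℝ) ≤ 16 ^ (j + 1) := by
      calc (16 : ℝ) = 16 ^ 1 := (pow_one _).symm
        _ ≤ 16 ^ (j + 1) := pow_le_pow_right₀ (by norm_num) (by omega)
    rw [div_le_iff₀ (by positivity)]
    nlinarith
  have hband : ∀ k l, ¬ (lam ≤ r k l u ∧ r k l u < 16 * lam) := by
    intro k l h
    have hmem : r k l u ∈ sfin := Finset.mem_image.mpr ⟨(k, l), by simp, rfl⟩
    exact hfree _ hmem ⟨by rw [hlam] at h; exact h.1, by rw [h16lam] at h; exact h.2⟩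
  -- the classes at `u`
  have hdiag : ∀ k, r k k u = 0 := fun k ↦ by simp [hr]
  have hsymm : ∀ k l, r k l u = r l k u := fun k l ↦ by simp only [hr, norm_sub_rev]
  have htri : ∀ k l m, r k m u ≤ r k l u + r l m u := by
    intro k l m
    simp only [hr, ← add_div]
    exact div_le_div_of_nonneg_right (norm_sub_le_norm_sub_add_norm_sub _ _ _) (hcs u hut).le
  obtain ⟨hself, hin, hout, hcls⟩ := ratioClasses (fun k l ↦ r k l u) hlam_pos hdiag hsymm htri hband
  set cls : Fin N → Finset (Fin N) := fun k ↦ Finset.univ.filter fun l ↦ r k l u < lam with hclsdef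
  -- the hitting set and the segment end
  set HIT : Set ℝ := {s | s ∈ Set.Icc u t₂ ∧ ∃ k l, l ∉ cls k ∧ r k l s ≤ 4 * lam} with hHIT
  have hrcont : ∀ k l, ContinuousOn (r k l) (Set.Icc u t₂) := fun k l ↦
    (continuousOn_ratio (hξ k).continuous (hξ l).continuous hc₀ hu0 (t₂ := t₂))
  have hHITclosed : IsClosed HIT := by
    have : HIT = ⋃ k, ⋃ l, {s | s ∈ Set.Icc u t₂ ∧ (l ∉ cls k ∧ r k l s ≤ 4 * lam)} := by
      ext s; simp only [hHIT, Set.mem_setOf_eq, Set.mem_iUnion]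
      constructor
      · rintro ⟨hs, k, l, h⟩; exact ⟨k, l, hs, h⟩
      · rintro ⟨k, l, hs, h⟩; exact ⟨hs, k, l, h⟩
    rw [this]
    refine isClosed_iUnion_of_finite fun k ↦ isClosed_iUnion_of_finite fun l ↦ ?_
    by_cases hl : l ∉ cls k
    · have h1 : {s | s ∈ Set.Icc u t₂ ∧ (l ∉ cls k ∧ r k l s ≤ 4 * lam)} = Set.Icc u t₂ ∩ (r k l) ⁻¹' Set.Iic (4 * lam) := by
        ext s; simp [hl]
      rw [h1]
      exact (hrcont k l).preimage_isClosed_of_isClosed isClosed_Icc isClosed_Iic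
    · have h1 : {s | s ∈ Set.Icc u t₂ ∧ (l ∉ cls k ∧ r k l s ≤ 4 * lam)} = ∅ := by
        ext s; simp only [Set.mem_setOf_eq, Set.mem_empty_iff_false, iff_false]; exact fun h ↦ hl h.2.1
      rw [h1]; exact isClosed_empty
  have hHITbdd : BddBelow HIT := ⟨u, fun s hs ↦ hs.1.1⟩
  -- choose τ
  obtain ⟨τ, hτ, hτcross, hτend⟩ : ∃ τ ∈ Set.Icc u t₂,
      (∀ s ∈ Set.Icc u τ, ∀ k l, l ∉ cls k → 4 * lam ≤ r k l s) ∧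
      (τ = t₂ ∨ (τ ∈ HIT ∧ ∀ s ∈ Set.Ico u τ, s ∉ HIT)) := by
    by_cases hne : HIT.Nonempty
    · have hmem : sInf HIT ∈ HIT := hHITclosed.csInf_mem hne hHITbdd
      have hbefore : ∀ s ∈ Set.Ico u (sInf HIT), s ∉ HIT := fun s hs hsH ↦
        absurd (csInf_le hHITbdd hsH) (not_le.mpr hs.2)
      have hlarge : ∀ s ∈ Set.Ico u (sInf HIT), ∀ k l, l ∉ cls k → 4 * lam < r k l s := by
        intro s hs k l hl
        by_contra h
        push Not at h
        exact hbefore s hs ⟨⟨hs.1, hs.2.le.trans hmem.1.2⟩, k, l, hl, h⟩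
      refine ⟨sInf HIT, ⟨hmem.1.1, hmem.1.2⟩, ?_, Or.inr ⟨hmem, hbefore⟩⟩
      intro s hs k l hl
      rcases eq_or_lt_of_le hs.2 with heq | hlt
      · rcases eq_or_lt_of_le hs.1 with heq' | hlt'
        · rw [← heq']; have := hout k k (hself k) l hl; linarith
        · -- limit from the left at the hitting time
          rw [heq]
          have hcw : ContinuousWithinAt (r k l) (Set.Ico u (sInf HIT)) (sInf HIT) :=
            ((hrcont k l).continuousWithinAt ⟨hmem.1.1, hmem.1.2⟩).mono
              fun x hx ↦ ⟨hx.1, hx.2.le.trans hmem.1.2⟩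
          have hus : u < sInf HIT := heq ▸ hlt'
          haveI : (𝓝[Set.Ico u (sInf HIT)] (sInf HIT)).NeBot := by
            apply mem_closure_iff_nhdsWithin_neBot.mp
            rw [closure_Ico hus.ne]
            exact ⟨hus.le, le_rfl⟩
          have hev : ∀ᶠ x in 𝓝[Set.Ico u (sInf HIT)] (sInf HIT), 4 * lam ≤ r k l x :=
            eventually_nhdsWithin_of_forall fun x hx ↦ (hlarge x hx k l hl).le
          exact ge_of_tendsto hcw hev
      · exact (hlarge s ⟨hs.1, hlt⟩ k l hl).le
    · refine ⟨t₂, ⟨hu.2, le_rfl⟩, ?_, Or.inl rfl⟩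
      intro s hs k l hl
      by_contra hlt4
      push Not at hlt4
      exact hne ⟨s, ⟨hs, k, l, hl, hlt4.le⟩⟩
  have hτ' : τ ∈ Set.Icc t₁ t₂ := ⟨hut.trans hτ.1, hτ.2⟩
  have hIcc_sub : ∀ s ∈ Set.Icc u τ, s ∈ Set.Icc t₁ t₂ := fun s hs ↦ ⟨hut.trans hs.1, hs.2.trans hτ.2⟩
  -- in-class ratios stay `< lam` on `[u, τ]`
  have hinclass : ∀ s ∈ Set.Icc u τ, ∀ k, ∀ i ∈ cls k, ‖ξ i s - ξ k s‖ < lam * (c₀ * s) := by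
    intro s hs k i hi
    have h0 : r k i u < lam := hin k k (hself k) i hi
    have h1 := noup k i lam hlam_ge u hu s (hIcc_sub s hs) hs.1 h0
    rw [hr_lt_iff k i s lam (hIcc_sub s hs).1] at h1
    rwa [norm_sub_rev]
  -- useful numeric facts
  have hu_rpow : (u ^ (1 / 2 : ℝ))⁻¹ ≤ (t₁ ^ (1 / 2 : ℝ))⁻¹ :=
    inv_anti₀ (Real.rpow_pos_of_pos ht₁ _) (Real.rpow_le_rpow ht₁.le hut (by norm_num))
  have hlamc : ((4 * lam * c₀) ^ (3 / 2 : ℝ))⁻¹ ≤ ((4 * lmin * c₀) ^ (3 / 2 : ℝ))⁻¹ :=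
    inv_anti₀ (Real.rpow_pos_of_pos (by positivity) _)
      (Real.rpow_le_rpow (by positivity) (by nlinarith [hlam_ge, hc₀]) (by norm_num))
  have hζu : ζ u ≤ ζstar := hζ u hu
  have hζτ : ζ τ ≤ ζstar := hζ τ hτ'
  have hc32 : 0 ≤ (c₀ ^ (3 / 2 : ℝ))⁻¹ := inv_nonneg.mpr (Real.rpow_nonneg hc₀.le _)
  have ht12 : 0 ≤ (t₁ ^ (1 / 2 : ℝ))⁻¹ := inv_nonneg.mpr (Real.rpow_nonneg ht₁.le _)
  have hl32 : 0 ≤ ((4 * lmin * c₀) ^ (3 / 2 : ℝ))⁻¹ := inv_nonneg.mpr (Real.rpow_nonneg (by positivity) _)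
  have hN0 : (0 : ℝ) ≤ N := Nat.cast_nonneg _
  -- PIECE BOUNDS
  have hpiece : ∀ k, |∑ i ∈ cls k, M i * (√(1 - ‖v i τ‖ ^ 2))⁻¹ - ∑ i ∈ cls k, M i * (√(1 - ‖v i u‖ ^ 2))⁻¹| ≤ X ∧
      ∀ kk : Fin 3, |∑ i ∈ cls k, M i * (√(1 - ‖v i τ‖ ^ 2))⁻¹ * v i τ kk -
        ∑ i ∈ cls k, M i * (√(1 - ‖v i u‖ ^ 2))⁻¹ * v i u kk| ≤ X := by
    intro k
    by_cases huniv : cls k = Finset.univ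
    · -- one piece of radius `c₀ s`
      have htight : ∀ s ∈ Set.Icc u τ, ∀ i, ‖ξ i s - ξ k s‖ ≤ (κ - κ ^ 2) / 2 * s / 2 := by
        intro s hs i
        have hi : i ∈ cls k := huniv ▸ Finset.mem_univ i
        have h1 := hinclass s hs k i hi
        have hs0 : 0 < c₀ * s := hcs s (hIcc_sub s hs).1
        have : lam * (c₀ * s) ≤ c₀ * s / 2 := by nlinarith
        rw [← hc₀def]; linarith
      have hρ' : ∀ s ∈ Set.Icc u τ, ρ s ≤ (κ - κ ^ 2) / 2 * s / 2 := by
        intro s hs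
        have h1 := hρ s (hIcc_sub s hs)
        have hs0 : 0 < c₀ * s := hcs s (hIcc_sub s hs).1
        have hl : 4 / 3 * lmin ≤ 1 / 2 := by
          have : lmin ≤ lam := hlam_ge; linarith
        rw [← hc₀def]
        nlinarith
      have h := univ_increment M ξ v κ P ρ C T T' T₀ ζ hWL hID hC hκ0 hκ1
        (fun i ↦ (hξ i).differentiable one_ne_zero) (fun i s hs ↦ (hspeed1 i s hs).trans (by norm_num)) k
        (hT.trans hut) (hT'.trans hut) (hT₀.trans hut) hu0 hτ.1 (fun s hs ↦ hcone k s (hIcc_sub s hs)) hρ' htight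
      rw [huniv]
      have hb : C * (2 * (((κ - κ ^ 2) / 2) ^ (3 / 2 : ℝ))⁻¹ * (u ^ (1 / 2 : ℝ))⁻¹) + ζ u + ζ τ ≤ X := by
        rw [hX, ← hc₀def]
        have h1 : C * (2 * (c₀ ^ (3 / 2 : ℝ))⁻¹ * (u ^ (1 / 2 : ℝ))⁻¹) ≤ C * (2 * (c₀ ^ (3 / 2 : ℝ))⁻¹ * (t₁ ^ (1 / 2 : ℝ))⁻¹) :=
          mul_le_mul_of_nonneg_left (mul_le_mul_of_nonneg_left hu_rpow (by positivity)) hC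
        have h2 : 0 ≤ C * (N * (2 * (2 * ((4 * lmin * c₀) ^ (3 / 2 : ℝ))⁻¹ * (t₁ ^ (1 / 2 : ℝ))⁻¹))) := by positivity
        nlinarith
      exact ⟨h.1.trans hb, fun kk ↦ (h.2 kk).trans hb⟩
    · -- a proper piece: far non-members
      have hSc : (Finset.univ \ cls k).Nonempty := by
        rw [Finset.sdiff_nonempty]; intro hsub
        exact huniv (Finset.eq_univ_of_forall fun x ↦ hsub (Finset.mem_univ x))
      have hmemSc : ∀ j, j ∈ Finset.univ \ cls k ↔ j ∉ cls k := fun j ↦ by simp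
      have hfarF : ∀ j ∈ Finset.univ \ cls k, ∀ s ∈ Set.Icc u τ, 4 * lam * c₀ * s ≤ ‖ξ j s - ξ k s‖ := by
        intro j hj s hs
        have h1 := hτcross s hs k j ((hmemSc j).mp hj)
        rw [hr_le_iff k j s (4 * lam) (hIcc_sub s hs).1, norm_sub_rev] at h1
        linarith
      have hinf : ∀ s ∈ Set.Icc u τ, 4 * lam * c₀ * s ≤ (Finset.univ \ cls k).inf' hSc fun j ↦ ‖ξ j s - ξ k s‖ := by
        intro s hs
        exact Finset.le_inf' _ _ fun j hj ↦ hfarF j hj s hs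
      have hhalf : ∀ s ∈ Set.Icc u τ, 4 / 3 * lam * (c₀ * s) ≤
          min ((κ - κ ^ 2) / 2 * s) (2 / 3 * (Finset.univ \ cls k).inf' hSc fun j ↦ ‖ξ j s - ξ k s‖) / 2 := by
        intro s hs
        have hs0 : 0 < c₀ * s := hcs s (hIcc_sub s hs).1
        have h1 := hinf s hs
        rw [← hc₀def]
        rw [le_div_iff₀ (by norm_num : (0 : ℝ) < 2), le_min_iff]
        constructor
        · nlinarith
        · nlinarith
      have hρ'' : ∀ s ∈ Set.Icc u τ,
          ρ s ≤ min ((κ - κ ^ 2) / 2 * s) (2 / 3 * (Finset.univ \ cls k).inf' hSc fun j ↦ ‖ξ j s - ξ k s‖) / 2 := by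
        intro s hs
        refine le_trans ?_ (hhalf s hs)
        have h1 := hρ s (hIcc_sub s hs)
        have hs0 : 0 < c₀ * s := hcs s (hIcc_sub s hs).1
        nlinarith [hlam_ge]
      have htight'' : ∀ s ∈ Set.Icc u τ, ∀ i ∈ cls k,
          ‖ξ i s - ξ k s‖ ≤ min ((κ - κ ^ 2) / 2 * s) (2 / 3 * (Finset.univ \ cls k).inf' hSc fun j ↦ ‖ξ j s - ξ k s‖) / 2 := by
        intro s hs i hi
        refine le_trans ?_ (hhalf s hs)
        have h1 := hinclass s hs k i hi
        have hs0 : 0 < c₀ * s := hcs s (hIcc_sub s hs).1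
        nlinarith
      have h := tight_increment_mixed M ξ v κ P ρ C T T' T₀ ζ hWL hID hC hκ0 hκ1 hξ hspeed1
        (S := cls k) (B := ∅) (F := Finset.univ \ cls k) (a := k) hSc (fun j hj ↦ Or.inr hj)
        (hT.trans hut) (hT'.trans hut) (hT₀.trans hut) hu0 hτ.1 one_pos one_pos (by positivity : (0 : ℝ) < 4 * lam * c₀)
        (fun s hs ↦ hcone k s (hIcc_sub s hs)) (fun _ ↦ 0) (fun j hj ↦ absurd hj (Finset.notMem_empty j))
        (fun j hj ↦ absurd hj (Finset.notMem_empty j)) (fun j hj ↦ absurd hj (Finset.notMem_empty j)) hfarF hρ'' htight''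
      have hb : C * (2 * (((κ - κ ^ 2) / 2) ^ (3 / 2 : ℝ))⁻¹ * (u ^ (1 / 2 : ℝ))⁻¹ +
          (∅ : Finset (Fin N)).card * (2 * (2 * √2 * (8 / (1 * √1)))) +
          (Finset.univ \ cls k).card * (2 * (2 * ((4 * lam * c₀) ^ (3 / 2 : ℝ))⁻¹ * (u ^ (1 / 2 : ℝ))⁻¹))) + ζ u + ζ τ ≤ X := by
        rw [hX, ← hc₀def, Finset.card_empty, Nat.cast_zero, zero_mul, add_zero]
        have hcard : ((Finset.univ \ cls k).card : ℝ) ≤ N := by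
          have := Finset.card_le_univ (Finset.univ \ cls k)
          rw [Fintype.card_fin] at this; exact_mod_cast this
        have h1 : (c₀ ^ (3 / 2 : ℝ))⁻¹ * (u ^ (1 / 2 : ℝ))⁻¹ ≤ (c₀ ^ (3 / 2 : ℝ))⁻¹ * (t₁ ^ (1 / 2 : ℝ))⁻¹ :=
          mul_le_mul_of_nonneg_left hu_rpow hc32
        have h2 : ((4 * lam * c₀) ^ (3 / 2 : ℝ))⁻¹ * (u ^ (1 / 2 : ℝ))⁻¹ ≤ ((4 * lmin * c₀) ^ (3 / 2 : ℝ))⁻¹ * (t₁ ^ (1 / 2 : ℝ))⁻¹ :=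
          mul_le_mul hlamc hu_rpow (inv_nonneg.mpr (Real.rpow_nonneg hu0.le _)) hl32
        have h3 : ((Finset.univ \ cls k).card : ℝ) * (2 * (2 * ((4 * lam * c₀) ^ (3 / 2 : ℝ))⁻¹ * (u ^ (1 / 2 : ℝ))⁻¹)) ≤
            N * (2 * (2 * ((4 * lmin * c₀) ^ (3 / 2 : ℝ))⁻¹ * (t₁ ^ (1 / 2 : ℝ))⁻¹)) := by
          have h2' : 2 * (2 * ((4 * lam * c₀) ^ (3 / 2 : ℝ))⁻¹ * (u ^ (1 / 2 : ℝ))⁻¹) ≤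
              2 * (2 * ((4 * lmin * c₀) ^ (3 / 2 : ℝ))⁻¹ * (t₁ ^ (1 / 2 : ℝ))⁻¹) := by nlinarith
          exact mul_le_mul hcard h2' (by positivity) hN0
        have h4 := mul_le_mul_of_nonneg_left (add_le_add (mul_le_mul_of_nonneg_left h1 (by norm_num : (0:ℝ) ≤ 2)) h3) hC
        nlinarith [h4, hζu, hζτ]
      exact ⟨h.1.trans hb, fun kk ↦ (h.2 kk).trans hb⟩
  -- TOTAL over the classes
  refine ⟨τ, hτ, ⟨?_, fun kk ↦ ?_⟩, ?_⟩
  · exact abs_sub_sum_classes_le cls hcls _ _ fun k ↦ (hpiece k).1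
  · exact abs_sub_sum_classes_le cls hcls (fun i ↦ M i * (√(1 - ‖v i τ‖ ^ 2))⁻¹ * v i τ kk)
      (fun i ↦ M i * (√(1 - ‖v i u‖ ^ 2))⁻¹ * v i u kk) fun k ↦ (hpiece k).2 kk
  -- FUEL
  rcases hτend with h | ⟨hmemHIT, -⟩
  · exact Or.inl h
  right
  set FU : ℝ → Finset ((Fin N × Fin N) × ℕ) := fun s ↦
    ((Finset.univ : Finset (Fin N × Fin N)) ×ˢ Finset.range (N * N + 2)).filter fun q ↦
      2⁻¹ / 16 ^ q.2 ≤ ‖ξ q.1.1 s - ξ q.1.2 s‖ / ((κ - κ ^ 2) / 2 * s) with hFU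
  show (FU τ).card + 1 ≤ (FU u).card
  have hsub : FU τ ⊆ FU u := by
    intro q hq
    rw [hFU, Finset.mem_filter] at hq ⊢
    refine ⟨hq.1, ?_⟩
    have hb : q.2 < N * N + 2 := Finset.mem_range.mp (Finset.mem_product.mp hq.1).2
    have hlev : lmin ≤ 2⁻¹ / 16 ^ q.2 := by
      rw [hlmin]
      exact div_le_div_of_nonneg_left (by norm_num) (by positivity) (pow_le_pow_right₀ (by norm_num) (by omega))
    by_contra hlt
    push Not at hlt
    have h1 := noup q.1.1 q.1.2 _ hlev u hu τ hτ' hτ.1 (by simpa [hr, hc₀def] using hlt)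
    have h2 : 2⁻¹ / 16 ^ q.2 ≤ r q.1.1 q.1.2 τ := by simpa [hr, hc₀def] using hq.2
    linarith
  obtain ⟨k, l, hl, hkl⟩ := hmemHIT.2
  have hq₀u : ((k, l), j) ∈ FU u := by
    rw [hFU, Finset.mem_filter]
    refine ⟨Finset.mem_product.mpr ⟨Finset.mem_univ _, Finset.mem_range.mpr (by omega)⟩, ?_⟩
    have h1 : 16 * lam ≤ r k l u := hout k k (hself k) l hl
    rw [h16lam] at h1
    simpa [hr, hc₀def] using h1
  have hq₀τ : ((k, l), j) ∉ FU τ := by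
    rw [hFU, Finset.mem_filter]
    intro h
    have h1 : 2⁻¹ / 16 ^ j ≤ r k l τ := by simpa [hr, hc₀def] using h.2
    rw [← h16lam] at h1
    linarith
  have hss : FU τ ⊂ FU u := Finset.ssubset_iff_of_subset hsub |>.mpr ⟨_, hq₀u, hq₀τ⟩
  have := Finset.card_lt_card hss
  omega

/-- Registered helper form: consecutive grid levels differ by the factor `16` (carrier of this file). [folklore] -/
theorem oracle_sixteen_mul_level : ∀ (j : ℕ), (16 : ℝ) * (2⁻¹ / 16 ^ (j + 1)) = 2⁻¹ / 16 ^ j := by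
  intro j
  rw [pow_succ]; field_simp

end Summit.FinalStateConjecture.FinalStateConjecture.Theorems.SublinearIsFree.Oracle

end
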